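import Summits.CriticalPhenomena.PercolationContinuityZ3.Theorems.PercNearOneGluingNoHeavyQuantFarSunSharpFlank
import HarnessLib

/-!
# FAR beyond trees: the SHARP boost of a central position at every layer, and the Chernoff form of the charged deficit

builds on p205010 (kernel theorem, internal audit signed; external expert review pending)

Support file (`--supports stmt-CriticalPhenomena-4575`), seat `prim-cert-1` (gen 42); memo `prim-cert-1/FROM-prim-cert-1-g42-SHARP-LARGEK.md`.
Layer `j ≥ 1`; `h⁰ = update h k 0` (hair `k` removed), `L = range k`, `R = {i < K : k < i}`, `g(a,b) = 𝟙[j ≤ a, j ≤ b]/(a+b+1−2j)`.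
With the tools of `…QuantFarSunSharpFlank`:

* `HairyCycle.boost_ge_flankEff_gen` — the boost `a_k = Σ_{Q ⊆ range K ∖ {k}} hairW K h Q · witAvgKernel j (insert k Q) k` of position `k` is at least
  `(1 − h k)·X_k`, `X_k = Σ_Q hairW K h⁰ Q·g(#(Q∩L), #(Q∩R))` (kernel mass `≥ 1/(A+B+1−2j)` by `card_wit_add_le`);
* `HairyCycle.flankEff_ge_gen` — `ρ³ ≤ X_k·(Σ − (2j−1)ρ)` when the hair mass strictly on each side of `k` is `≥ M ≥ j` and
  `0 < ρ ≤ 1 − e^{−(1−θ)M}/θ^{j−1}` (`0 < θ ≤ 1`; Chernoff for both flanks, joint law = product, Cauchy–Schwarz);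
* **`HairyCycle.boost_ge_sharp`** — hence `(1 − h k)·ρ³/(Σ − (2j−1)ρ) ≤ a_k` for such `k`;
* **`HairyCycle.noWit_erase_le_chernoff`** — `Σ_{Q ⊆ range K ∖ {k}} hairW K h⁰ Q·𝟙[wit j Q = ∅] ≤ e^{−(1−θ)(Σ − h k)}/θ^{2j}` (`0 < θ ≤ 1`).
No definitions, no sorries, standard axioms.  Elementary [this work].
-/

noncomputable section

namespace Summit.CriticalPhenomena.PercolationContinuityZ3.Theorems.HairyCycle

open Finset
open scoped Classical

variable {K : ℕ}

/-! ## The boost of a flanked position dominates its layer-`j` flank efficiency -/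

/-- **The boost of position `k` dominates `(1 − h k)` times its layer-`j` flank efficiency** (`k < K`, `0 ≤ h ≤ 1` on `range K`):
with `L = range k`, `R = {i < K : k < i}`, `h⁰ = update h k 0` and `g(a,b) = 𝟙[j ≤ a, j ≤ b]/(a+b+1−2j)`,
`(1 − h k)·Σ_{Q ⊆ range K} hairW K h⁰ Q·g(#(Q∩L), #(Q∩R)) ≤ Σ_{Q ⊆ range K ∖ {k}} hairW K h Q·witAvgKernel j (insert k Q) k`
(opening `k` on a pattern with `≥ j` open hairs on each side makes it a witness of a pattern with at most `A + B + 1 − 2j` witnesses,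
`HairyCycle.card_wit_add_le`). [this work] -/
theorem boost_ge_flankEff_gen {h : ℕ → ℝ} (hh : ∀ i, i < K → 0 ≤ h i ∧ h i ≤ 1) (j : ℕ) {k : ℕ} (hk : k < K) :
    (1 - h k) * ∑ Q ∈ (range K).powerset, hairW K (Function.update h k 0) Q *
        (if j ≤ (Q ∩ range k).card ∧ j ≤ (Q ∩ (range K).filter (fun i => k < i)).card
          then 1 / (((Q ∩ range k).card : ℝ) + (Q ∩ (range K).filter (fun i => k < i)).card + 1 - 2 * j) else 0) ≤
      ∑ Q ∈ ((range K).erase k).powerset, hairW K h Q * witAvgKernel j (insert k Q) k := by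
  have hkS : k ∉ (range K).erase k := Finset.notMem_erase k _
  -- patterns containing `k` have no weight under `h⁰`
  have hsplit : ∑ Q ∈ (range K).powerset, hairW K (Function.update h k 0) Q *
        (if j ≤ (Q ∩ range k).card ∧ j ≤ (Q ∩ (range K).filter (fun i => k < i)).card
          then 1 / (((Q ∩ range k).card : ℝ) + (Q ∩ (range K).filter (fun i => k < i)).card + 1 - 2 * j) else 0) =
      ∑ Q ∈ ((range K).erase k).powerset, hairW K (Function.update h k 0) Q *
        (if j ≤ (Q ∩ range k).card ∧ j ≤ (Q ∩ (range K).filter (fun i => k < i)).card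
          then 1 / (((Q ∩ range k).card : ℝ) + (Q ∩ (range K).filter (fun i => k < i)).card + 1 - 2 * j) else 0) := by
    symm
    refine Finset.sum_subset (Finset.powerset_mono.2 (Finset.erase_subset k (range K))) fun Q hQ hQ' => ?_
    rw [Finset.mem_powerset] at hQ hQ'
    have hkQ : k ∈ Q := by
      by_contra hkQ
      exact hQ' fun e he => Finset.mem_erase.2 ⟨fun hek => hkQ (hek ▸ he), hQ he⟩
    rw [hairW_eq_zero_of_mem hk hkQ (Function.update_self k (0 : ℝ) h), zero_mul]
  rw [hsplit, Finset.mul_sum]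
  refine Finset.sum_le_sum fun Q hQ => ?_
  rw [Finset.mem_powerset] at hQ
  have hkQ : k ∉ Q := fun hm => hkS (hQ hm)
  rw [hairW_eq_mul_erase h hk hkQ]
  have hw0 : 0 ≤ hairW K (Function.update h k 0) Q :=
    hairW_nonneg (fun i hi => by
      by_cases hik : i = k
      · rw [hik, Function.update_self]; norm_num
      · rw [Function.update_of_ne hik]; exact hh i hi) Q
  have hu : 0 ≤ 1 - h k := by linarith [(hh k hk).2]
  have e : (1 - h k) * (hairW K (Function.update h k 0) Q *
      (if j ≤ (Q ∩ range k).card ∧ j ≤ (Q ∩ (range K).filter (fun i => k < i)).card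
        then 1 / (((Q ∩ range k).card : ℝ) + (Q ∩ (range K).filter (fun i => k < i)).card + 1 - 2 * j) else 0)) =
      (1 - h k) * hairW K (Function.update h k 0) Q *
      (if j ≤ (Q ∩ range k).card ∧ j ≤ (Q ∩ (range K).filter (fun i => k < i)).card
        then 1 / (((Q ∩ range k).card : ℝ) + (Q ∩ (range K).filter (fun i => k < i)).card + 1 - 2 * j) else 0) := by ring
  rw [e]
  refine mul_le_mul_of_nonneg_left ?_ (mul_nonneg hu hw0)
  split_ifs with hab
  · have hmem := mem_wit_insert_gen (K := K) hab.1 hab.2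
    unfold witAvgKernel
    rw [if_pos hmem]
    have hwit := card_wit_add_le (j := j) (Q := insert k Q) ⟨k, hmem⟩
    have h2 : (insert k Q).card = Q.card + 1 := Finset.card_insert_of_notMem hkQ
    rw [card_eq_left_add_right hQ] at h2
    have hcard : ((wit j (insert k Q)).card : ℝ) ≤ ((Q ∩ range k).card : ℝ) + (Q ∩ (range K).filter (fun i => k < i)).card + 1 - 2 * j := by
      have h3 : (wit j (insert k Q)).card + 2 * j ≤ (Q ∩ range k).card + (Q ∩ (range K).filter (fun i => k < i)).card + 1 := by
        rw [← h2]; exact hwit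
      have h4 : (((wit j (insert k Q)).card + 2 * j : ℕ) : ℝ) ≤ (((Q ∩ range k).card + (Q ∩ (range K).filter (fun i => k < i)).card + 1 : ℕ) : ℝ) := by
        exact_mod_cast h3
      push_cast at h4
      linarith
    have hpos : (0 : ℝ) < (wit j (insert k Q)).card := by exact_mod_cast Finset.card_pos.2 ⟨k, hmem⟩
    exact one_div_le_one_div_of_le hpos hcard
  · unfold witAvgKernel
    split_ifs
    · exact div_nonneg zero_le_one (Nat.cast_nonneg _)
    · exact le_rfl

/-- **Sharp flank efficiency of a central position.**  Let `1 ≤ j ≤ M`, `0 < θ ≤ 1`, `0 < ρ ≤ 1 − e^{−(1−θ)M}/θ^{j−1}`, `0 ≤ h ≤ 1` on `range K`,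
`k < K` with `M ≤ Σ_{i<k} h i` and `M ≤ Σ_{k<i<K} h i`, `h⁰ = update h k 0`.  Then with `L = range k`, `R = {i < K : k < i}` and
`g(a,b) = 𝟙[j ≤ a, j ≤ b]/(a+b+1−2j)`:  `ρ³ ≤ (Σ_{Q ⊆ range K} hairW K h⁰ Q · g(#(Q∩L), #(Q∩R))) · (Σ_{i<K} h i − (2j−1)ρ)`
(both flank probabilities are `≥ ρ` by Chernoff; Cauchy–Schwarz; first moments `≤ Σ_L − jπ_L`, `Σ_R − jπ_R`). [this work] -/
theorem flankEff_ge_gen {h : ℕ → ℝ} (hh : ∀ i, i < K → 0 ≤ h i ∧ h i ≤ 1) {j : ℕ} (hj : 1 ≤ j) {k : ℕ} (hk : k < K)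
    {M θ ρ : ℝ} (hMj : (j : ℝ) ≤ M) (hθ0 : 0 < θ) (hθ1 : θ ≤ 1) (hρ0 : 0 < ρ)
    (hρ : ρ ≤ 1 - Real.exp (-(1 - θ) * M) / θ ^ (j - 1))
    (hL : M ≤ ∑ i ∈ range k, h i) (hR : M ≤ ∑ i ∈ (range K).filter (fun i => k < i), h i) :
    ρ ^ 3 ≤ (∑ Q ∈ (range K).powerset, hairW K (Function.update h k 0) Q *
        (if j ≤ (Q ∩ range k).card ∧ j ≤ (Q ∩ (range K).filter (fun i => k < i)).card
          then 1 / (((Q ∩ range k).card : ℝ) + (Q ∩ (range K).filter (fun i => k < i)).card + 1 - 2 * j) else 0)) *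
      (∑ i ∈ range K, h i - (2 * j - 1) * ρ) := by
  have hj1 : j - 1 + 1 = j := Nat.sub_add_cancel hj
  have hh0 : ∀ i, i < K → 0 ≤ Function.update h k 0 i ∧ Function.update h k 0 i ≤ 1 := by
    intro i hi
    by_cases hik : i = k
    · rw [hik, Function.update_self]; norm_num
    · rw [Function.update_of_ne hik]; exact hh i hi
  have hLR : Disjoint (range k) ((range K).filter (fun i => k < i)) := by
    rw [Finset.disjoint_left]
    intro i hi hi'
    rw [Finset.mem_range] at hi
    rw [Finset.mem_filter] at hi'
    omega
  -- joint law
  rw [sum_hairW_fun_two_counts (K := K) (Function.update h k 0) hLR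
    (fun a b => if j ≤ a ∧ j ≤ b then 1 / ((a : ℝ) + b + 1 - 2 * j) else 0)]
  -- restrict to `a, b ≥ j`
  have hX : ∑ a ∈ range (K + 1), ∑ b ∈ range (K + 1),
      (∑ Q ∈ (range K).powerset, hairW K (Function.update h k 0) Q * (if (Q ∩ range k).card = a then (1 : ℝ) else 0)) *
      (∑ Q ∈ (range K).powerset, hairW K (Function.update h k 0) Q * (if (Q ∩ (range K).filter (fun i => k < i)).card = b then (1 : ℝ) else 0)) *
      (if j ≤ a ∧ j ≤ b then 1 / ((a : ℝ) + b + 1 - 2 * j) else 0) =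
      ∑ a ∈ (range (K + 1)).filter (fun a => j ≤ a), ∑ b ∈ (range (K + 1)).filter (fun b => j ≤ b),
      (∑ Q ∈ (range K).powerset, hairW K (Function.update h k 0) Q * (if (Q ∩ range k).card = a then (1 : ℝ) else 0)) *
      (∑ Q ∈ (range K).powerset, hairW K (Function.update h k 0) Q * (if (Q ∩ (range K).filter (fun i => k < i)).card = b then (1 : ℝ) else 0)) /
      ((a : ℝ) + b + 1 - 2 * j) := by
    rw [Finset.sum_filter]
    refine Finset.sum_congr rfl fun a _ => ?_
    by_cases ha : j ≤ a
    · rw [if_pos ha, Finset.sum_filter]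
      refine Finset.sum_congr rfl fun b _ => ?_
      by_cases hb : j ≤ b
      · rw [if_pos ⟨ha, hb⟩, if_pos hb]; ring
      · rw [if_neg (fun hab => hb hab.2), if_neg hb]; ring
    · rw [if_neg ha]
      exact Finset.sum_eq_zero fun b _ => by rw [if_neg (fun hab => ha hab.1)]; ring
  rw [hX]
  -- means of the sides under `h⁰`
  have hmeanL : ∑ i ∈ (range K).filter (fun i => i ∈ range k), Function.update h k 0 i = ∑ i ∈ range k, h i := by
    have : (range K).filter (fun i => i ∈ range k) = range k := by
      ext i; rw [Finset.mem_filter, Finset.mem_range, Finset.mem_range]; omega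
    rw [this]
    exact Finset.sum_congr rfl fun i hi => by rw [Function.update_of_ne (by rw [Finset.mem_range] at hi; omega)]
  have hmeanR : ∑ i ∈ (range K).filter (fun i => i ∈ (range K).filter (fun i => k < i)), Function.update h k 0 i =
      ∑ i ∈ (range K).filter (fun i => k < i), h i := by
    have : (range K).filter (fun i => i ∈ (range K).filter (fun i => k < i)) = (range K).filter (fun i => k < i) := by
      ext i; simp only [Finset.mem_filter]; tauto
    rw [this]
    exact Finset.sum_congr rfl fun i hi => by
      rw [Finset.mem_filter] at hi
      rw [Function.update_of_ne (by omega)]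
  -- the count pmfs
  set p : ℕ → ℝ := fun a => ∑ Q ∈ (range K).powerset, hairW K (Function.update h k 0) Q * (if (Q ∩ range k).card = a then (1 : ℝ) else 0) with hpdef
  set q : ℕ → ℝ := fun b => ∑ Q ∈ (range K).powerset, hairW K (Function.update h k 0) Q *
      (if (Q ∩ (range K).filter (fun i => k < i)).card = b then (1 : ℝ) else 0) with hqdef
  have hnnL : ∀ a, 0 ≤ p a :=
    fun a => Finset.sum_nonneg fun Q _ => mul_nonneg (hairW_nonneg hh0 Q) (by split_ifs <;> norm_num)
  have hnnR : ∀ b, 0 ≤ q b :=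
    fun b => Finset.sum_nonneg fun Q _ => mul_nonneg (hairW_nonneg hh0 Q) (by split_ifs <;> norm_num)
  set A := (range (K + 1)).filter (fun a => j ≤ a) with hAdef
  -- masses `π_L, π_R ≥ ρ` (Chernoff)
  have hmassL := sum_countMass_ge_gen (K := K) (Function.update h k 0) (range k) (j - 1)
  have hmassR := sum_countMass_ge_gen (K := K) (Function.update h k 0) ((range K).filter (fun i => k < i)) (j - 1)
  rw [hj1] at hmassL hmassR
  change ∑ a ∈ A, p a = _ at hmassL
  change ∑ b ∈ A, q b = _ at hmassR
  have htailL := countTail_le_chernoff hh0 (range k) (j - 1) hθ0 hθ1 (M := M) (by rw [hmeanL]; exact hL)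
  have htailR := countTail_le_chernoff hh0 ((range K).filter (fun i => k < i)) (j - 1) hθ0 hθ1 (M := M) (by rw [hmeanR]; exact hR)
  have hπL : ρ ≤ ∑ a ∈ A, p a := by rw [hmassL]; linarith
  have hπR : ρ ≤ ∑ b ∈ A, q b := by rw [hmassR]; linarith
  -- first moments `≤ Σ_L − jπ_L`, `Σ_R − jπ_R`
  have hmL := sum_countMass_mul_le_mean_gen hh0 (range k) (j - 1)
  have hmR := sum_countMass_mul_le_mean_gen hh0 ((range K).filter (fun i => k < i)) (j - 1)
  rw [hj1, hmeanL] at hmL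
  rw [hj1, hmeanR] at hmR
  change ∑ a ∈ A, (a : ℝ) * p a ≤ _ at hmL
  change ∑ b ∈ A, (b : ℝ) * q b ≤ _ at hmR
  have hmL' : ∑ a ∈ A, ((a : ℝ) - j) * p a ≤ ∑ i ∈ range k, h i - j * ∑ a ∈ A, p a := by
    have e : ∑ a ∈ A, ((a : ℝ) - j) * p a = ∑ a ∈ A, (a : ℝ) * p a - j * ∑ a ∈ A, p a := by
      rw [Finset.mul_sum, ← Finset.sum_sub_distrib]
      exact Finset.sum_congr rfl fun a _ => by ring
    rw [e]; linarith
  have hmR' : ∑ b ∈ A, ((b : ℝ) - j) * q b ≤ ∑ i ∈ (range K).filter (fun i => k < i), h i - j * ∑ b ∈ A, q b := by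
    have e : ∑ b ∈ A, ((b : ℝ) - j) * q b = ∑ b ∈ A, (b : ℝ) * q b - j * ∑ b ∈ A, q b := by
      rw [Finset.mul_sum, ← Finset.sum_sub_distrib]
      exact Finset.sum_congr rfl fun b _ => by ring
    rw [e]; linarith
  -- Cauchy–Schwarz
  have hcs := flank_sum_lower_bound_gen K j p q hnnL hnnR
  rw [← hAdef] at hcs
  -- `Σ_L + Σ_R ≤ Σ`
  have hsplit : ∑ i ∈ range k, h i + ∑ i ∈ (range K).filter (fun i => k < i), h i ≤ ∑ i ∈ range K, h i := by
    have hsub : range k ∪ (range K).filter (fun i => k < i) ⊆ range K := by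
      intro i hi
      rw [Finset.mem_union, Finset.mem_range, Finset.mem_filter, Finset.mem_range] at hi
      rw [Finset.mem_range]; omega
    calc ∑ i ∈ range k, h i + ∑ i ∈ (range K).filter (fun i => k < i), h i
        = ∑ i ∈ range k ∪ (range K).filter (fun i => k < i), h i := (Finset.sum_union hLR).symm
      _ ≤ ∑ i ∈ range K, h i := Finset.sum_le_sum_of_subset_of_nonneg hsub fun i hi _ => (hh i (Finset.mem_range.1 hi)).1
  have hX0 : 0 ≤ ∑ a ∈ A, ∑ b ∈ A, p a * q b / ((a : ℝ) + b + 1 - 2 * j) := by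
    refine Finset.sum_nonneg fun a ha => Finset.sum_nonneg fun b hb => div_nonneg (mul_nonneg (hnnL a) (hnnR b)) ?_
    rw [hAdef, Finset.mem_filter] at ha hb
    have h1 : (j : ℝ) ≤ a := by exact_mod_cast ha.2
    have h2 : (j : ℝ) ≤ b := by exact_mod_cast hb.2
    linarith
  have hj' : (1 : ℝ) ≤ j := by exact_mod_cast hj
  exact flank_algebra_gen (j := (j : ℝ)) hρ0 hX0 hj' hcs hπL hπR hmL' hmR' (hMj.trans hL) (hMj.trans hR) hsplit

/-- **SHARP BOOST of a central position.**  Let `1 ≤ j ≤ M`, `0 < θ ≤ 1`, `0 < ρ ≤ 1 − e^{−(1−θ)M}/θ^{j−1}`, `0 ≤ h ≤ 1` on `range K` and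
`k < K` with hair mass `≥ M` strictly on each side (`M ≤ Σ_{i<k} h i`, `M ≤ Σ_{k<i<K} h i`).  Then
`(1 − h k)·ρ³/(Σ_{i<K} h i − (2j−1)ρ) ≤ a_k := Σ_{Q ⊆ range K ∖ {k}} hairW K h Q · witAvgKernel j (insert k Q) k`. [this work] -/
theorem boost_ge_sharp {h : ℕ → ℝ} (hh : ∀ i, i < K → 0 ≤ h i ∧ h i ≤ 1) {j : ℕ} (hj : 1 ≤ j) {k : ℕ} (hk : k < K)
    {M θ ρ : ℝ} (hMj : (j : ℝ) ≤ M) (hθ0 : 0 < θ) (hθ1 : θ ≤ 1) (hρ0 : 0 < ρ)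
    (hρ : ρ ≤ 1 - Real.exp (-(1 - θ) * M) / θ ^ (j - 1))
    (hL : M ≤ ∑ i ∈ range k, h i) (hR : M ≤ ∑ i ∈ (range K).filter (fun i => k < i), h i) :
    (1 - h k) * ρ ^ 3 / (∑ i ∈ range K, h i - (2 * j - 1) * ρ) ≤
      ∑ Q ∈ ((range K).erase k).powerset, hairW K h Q * witAvgKernel j (insert k Q) k := by
  have hF := flankEff_ge_gen hh hj hk hMj hθ0 hθ1 hρ0 hρ hL hR
  have hB := boost_ge_flankEff_gen hh j hk
  set X := ∑ Q ∈ (range K).powerset, hairW K (Function.update h k 0) Q *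
        (if j ≤ (Q ∩ range k).card ∧ j ≤ (Q ∩ (range K).filter (fun i => k < i)).card
          then 1 / (((Q ∩ range k).card : ℝ) + (Q ∩ (range K).filter (fun i => k < i)).card + 1 - 2 * j) else 0) with hXdef
  -- `ρ ≤ 1`, hence the denominator is positive
  have hρ1 : ρ ≤ 1 := by
    have : 0 ≤ Real.exp (-(1 - θ) * M) / θ ^ (j - 1) := div_nonneg (Real.exp_pos _).le (pow_nonneg hθ0.le _)
    linarith
  have hj' : (1 : ℝ) ≤ j := by exact_mod_cast hj
  have hLR : Disjoint (range k) ((range K).filter (fun i => k < i)) := by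
    rw [Finset.disjoint_left]
    intro i hi hi'
    rw [Finset.mem_range] at hi
    rw [Finset.mem_filter] at hi'
    omega
  have hsplit : ∑ i ∈ range k, h i + ∑ i ∈ (range K).filter (fun i => k < i), h i ≤ ∑ i ∈ range K, h i := by
    have hsub : range k ∪ (range K).filter (fun i => k < i) ⊆ range K := by
      intro i hi
      rw [Finset.mem_union, Finset.mem_range, Finset.mem_filter, Finset.mem_range] at hi
      rw [Finset.mem_range]; omega
    calc ∑ i ∈ range k, h i + ∑ i ∈ (range K).filter (fun i => k < i), h i
        = ∑ i ∈ range k ∪ (range K).filter (fun i => k < i), h i := (Finset.sum_union hLR).symm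
      _ ≤ ∑ i ∈ range K, h i := Finset.sum_le_sum_of_subset_of_nonneg hsub fun i hi _ => (hh i (Finset.mem_range.1 hi)).1
  have hden : 0 < ∑ i ∈ range K, h i - (2 * j - 1) * ρ := by nlinarith
  have hu : 0 ≤ 1 - h k := by linarith [(hh k hk).2]
  rw [div_le_iff₀ hden]
  calc (1 - h k) * ρ ^ 3 ≤ (1 - h k) * (X * (∑ i ∈ range K, h i - (2 * j - 1) * ρ)) := mul_le_mul_of_nonneg_left hF hu
    _ = (1 - h k) * X * (∑ i ∈ range K, h i - (2 * j - 1) * ρ) := by ring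
    _ ≤ _ := mul_le_mul_of_nonneg_right hB hden.le

/-! ## The deficit charged to a closed hair: Chernoff form -/

/-- **No-witness mass avoiding `k`, Chernoff form.**  For `0 ≤ h ≤ 1` on `range K`, `k < K`, `0 < θ ≤ 1` and `h⁰ = update h k 0`:
`Σ_{Q ⊆ range K ∖ {k}} hairW K h⁰ Q·𝟙[wit j Q = ∅] ≤ e^{−(1−θ)(Σ_{i<K} h i − h k)}/θ^{2j}`
(a pattern without a witness has at most `2j` members; Chernoff for the total open count under `h⁰`, whose mean is `Σ − h k`). [this work] -/
theorem noWit_erase_le_chernoff {h : ℕ → ℝ} (hh : ∀ i, i < K → 0 ≤ h i ∧ h i ≤ 1) (j : ℕ) {k : ℕ} (hk : k < K)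
    {θ : ℝ} (hθ0 : 0 < θ) (hθ1 : θ ≤ 1) :
    ∑ Q ∈ ((range K).erase k).powerset, hairW K (Function.update h k 0) Q * (if (wit j Q).Nonempty then (0 : ℝ) else 1) ≤
      Real.exp (-(1 - θ) * (∑ i ∈ range K, h i - h k)) / θ ^ (2 * j) := by
  have hh0 : ∀ i, i < K → 0 ≤ Function.update h k 0 i ∧ Function.update h k 0 i ≤ 1 := by
    intro i hi
    by_cases hik : i = k
    · rw [hik, Function.update_self]; norm_num
    · rw [Function.update_of_ne hik]; exact hh i hi
  -- no witness ⟹ at most `2j` members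
  have h1 : ∑ Q ∈ ((range K).erase k).powerset, hairW K (Function.update h k 0) Q * (if (wit j Q).Nonempty then (0 : ℝ) else 1) ≤
      ∑ Q ∈ ((range K).erase k).powerset, hairW K (Function.update h k 0) Q * (if (Q ∩ range K).card ≤ 2 * j then (1 : ℝ) else 0) := by
    refine Finset.sum_le_sum fun Q _ => mul_le_mul_of_nonneg_left ?_ (hairW_nonneg hh0 Q)
    by_cases hne : (wit j Q).Nonempty
    · rw [if_pos hne]; split_ifs <;> norm_num
    · have hc : Q.card ≤ 2 * j := card_le_of_wit_not_nonempty hne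
      have hc1 : (Q ∩ range K).card ≤ 2 * j := (Finset.card_le_card Finset.inter_subset_left).trans hc
      rw [if_neg hne, if_pos hc1]
  have h2 : ∑ Q ∈ ((range K).erase k).powerset, hairW K (Function.update h k 0) Q * (if (Q ∩ range K).card ≤ 2 * j then (1 : ℝ) else 0) ≤
      ∑ Q ∈ (range K).powerset, hairW K (Function.update h k 0) Q * (if (Q ∩ range K).card ≤ 2 * j then (1 : ℝ) else 0) :=
    Finset.sum_le_sum_of_subset_of_nonneg (Finset.powerset_mono.2 (Finset.erase_subset k (range K))) fun Q _ _ =>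
      mul_nonneg (hairW_nonneg hh0 Q) (by split_ifs <;> norm_num)
  -- the mean under `h⁰` is `Σ − h k`
  have hmean : ∑ i ∈ (range K).filter (fun i => i ∈ range K), Function.update h k 0 i = ∑ i ∈ range K, h i - h k := by
    have hf : (range K).filter (fun i => i ∈ range K) = range K := by ext i; simp
    rw [hf, Finset.sum_update_of_mem (Finset.mem_range.2 hk), Finset.sdiff_singleton_eq_erase]
    have := Finset.add_sum_erase (range K) h (Finset.mem_range.2 hk)
    linarith
  have h3 := countTail_le_chernoff hh0 (range K) (2 * j) hθ0 hθ1 (M := ∑ i ∈ range K, h i - h k) (by rw [hmean])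
  exact h1.trans (h2.trans h3)

end Summit.CriticalPhenomena.PercolationContinuityZ3.Theorems.HairyCycle

end
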